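import Mathlib
import HarnessLib
import Literature.Probability.Percolation.Percolation
import Literature.Probability.Percolation.PercolationEvents
import Literature.Probability.Percolation.TwoPointFunction
import Summits.CriticalPhenomena.PercolationContinuityZ3.Theses.PercTreeValue

/-!
# Sketch — crux-ideate stmt-CriticalPhenomena-7801 (TetrahedronLogConvexity), ideator 2

First lemmas of the two idea cards, stated over existing declarations so that they elaborate.
Nothing here is proved; `def … : Prop` only.

Geometry: `T_r = {0, a_r, b_r, c_r}`, `a_r = (r,r,0)`, `b_r = (r,0,r)`, `c_r = (0,r,r)`; the lattice
reflection `θ(x₀,x₁,x₂) = (x₁,x₀,x₂)` fixes `0, a_r` and swaps `b_r ↔ c_r`.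
-/

namespace Summit.CriticalPhenomena.PercolationContinuityZ3.Cruxes.TetrahedronLogConvexity.Ideator2

open MeasureTheory
open Literature.Probability.Percolation Literature.Probability.LatticeModels

noncomputable section

/-! ## Geometry of the lattice tetrahedron -/

def vA (r : ℕ) : Site 3 := ![(r : ℤ), (r : ℤ), 0]
def vB (r : ℕ) : Site 3 := ![(r : ℤ), 0, (r : ℤ)]
def vC (r : ℕ) : Site 3 := ![0, (r : ℤ), (r : ℤ)]

/-- the mirror `θ`: swap the first two coordinates. -/
def theta3 (x : Site 3) : Site 3 := ![x 1, x 0, x 2]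

/-! ## Card `russo-transport-bar-pivotals`: pivotal inclusion–exclusion -/

def E2 (r : ℕ) : Set (BondConfig (Site 3)) := openConn 0 (vA r)
def E3b (r : ℕ) : Set (BondConfig (Site 3)) := openConn 0 (vA r) ∩ openConn 0 (vB r)
def E3c (r : ℕ) : Set (BondConfig (Site 3)) := openConn 0 (vA r) ∩ openConn 0 (vC r)
def E4 (r : ℕ) : Set (BondConfig (Site 3)) :=
  openConn 0 (vA r) ∩ openConn 0 (vB r) ∩ openConn 0 (vC r)

/-- The disjoint-coexistence event `D_r = {0 ↔ a_r, b_r ↔ c_r, 0 ↮ b_r}` of the rank-2 crux. -/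
def Dcoex (r : ℕ) : Set (BondConfig (Site 3)) :=
  openConn 0 (vA r) ∩ openConn (vB r) (vC r) ∩ (openConn 0 (vB r))ᶜ

/-- Bar edges of `ω ∈ E4 r`: open edges whose removal leaves `{0,a}` and `{b,c}` connected but
separates the two pairs (the pivotal class `{0a}|{bc}`; on a tree these are the `m` edges of the
middle bar, `Φ₄ = p^{-m}`). -/
def barEdges (r : ℕ) (ω : BondConfig (Site 3)) : Set (Sym2 (Site 3)) :=
  {e | e ∈ ω ∧ ω \ {e} ∈ Dcoex r}

/-- Contact edges of `ω ∈ D_r`: closed lattice edges whose opening merges the two coexisting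
clusters into one cluster containing all of `T_r`. -/
def contactEdges (r : ℕ) (ω : BondConfig (Site 3)) : Set (Sym2 (Site 3)) :=
  {e | e ∈ (zdGraph 3).edgeSet ∧ e ∉ ω ∧ ω ∈ Dcoex r ∧ insert e ω ∈ E4 r}

/-- FIRST LEMMA (card russo-transport-bar-pivotals; elementary, provable now).  On the event that
the four vertices of `T_r` are joined, the pivotal sets of the two three-point events cover the
pivotal set of the four-point event, and meet exactly in the pivotal set of `{0 ↔ a}` plus the bar
edges.  Consequently `N₃ + N₃' = N₄ + N₂ + M` pointwise (inclusion–exclusion of finite sets), the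
identity that Russo's formula turns into
`-p · d/dp log Φ₄ = E_p[M | 0abc] + 3u₃ - 2u₄ - u₂` for the symmetric tetrahedron. -/
def PivotalInclusionExclusion : Prop :=
  ∀ (r : ℕ) (ω : BondConfig (Site 3)), ω ∈ E4 r →
    pivotals (E3b r) ω ∪ pivotals (E3c r) ω = pivotals (E4 r) ω ∧
    pivotals (E3b r) ω ∩ pivotals (E3c r) ω = pivotals (E2 r) ω ∪ barEdges r ω ∧
    Disjoint (pivotals (E2 r) ω) (barEdges r ω)

/-- SECOND STATEMENT of the same card (exchange identity; provable now for `p ≠ p_c`, where both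
sides are finite): the expected number of bar pivotals of the four-cluster equals `p/(1-p)` times
the expected contact number of the two coexisting clusters of the rank-2 crux event `D_r`
("log-convexity in k is fed by near-mergers"). Stated above `p_c`, where it is used. -/
def BarMassEqContact : Prop :=
  ∀ (p : unitInterval) (r : ℕ), criticalProbI 3 < p → (p : ℝ) < 1 →
    ∫ ω, ((barEdges r ω).encard.toNat : ℝ) ∂(bondPercolation (zdGraph 3) p) =
      (p : ℝ) / (1 - (p : ℝ)) *
        ∫ ω, ((contactEdges r ω).encard.toNat : ℝ) ∂(bondPercolation (zdGraph 3) p)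

/-- The transfer target of the card: with `u_k(p) :=` expected number of edges pivotal for
`{0 ↔ a_r}` given that the first `k` vertices of `T_r` are joined (`k = 2,3,4`) and
`m(p) := E_p[#barEdges | E4 r]`, the crux `TetrahedronLogConvexity` is EQUIVALENT to
`liminf_r ∫_{p_c}^1 (m + 3u₃ - 2u₄ - u₂) dp/p > 0`; the sufficient pointwise form below
("pinning toughens, with returns diminishing by less than half, plus the bar bonus") is what the
line would try to prove on a final segment of the supercritical window.  Conditional expectations
are written as ratios of integrals. -/
def SupercriticalIntegrandPositive : Prop :=
  ∃ η : ℝ, 0 < η ∧ ∃ r₀ : ℕ, ∀ r : ℕ, r₀ ≤ r → ∃ p₁ : unitInterval, criticalProbI 3 < p₁ ∧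
    ∀ p : unitInterval, criticalProbI 3 < p → p ≤ p₁ →
      let P := bondPercolation (zdGraph 3) p
      let u : Set (BondConfig (Site 3)) → ℝ := fun F =>
        (∫ ω in F, ((pivotals (E2 r) ω ∩ (zdGraph 3).edgeSet).encard.toNat : ℝ) ∂P) / P.real F
      let m : ℝ := (∫ ω in E4 r, ((barEdges r ω).encard.toNat : ℝ) ∂P) / P.real (E4 r)
      η * u (E2 r) ≤ m + 3 * u (E3b r) - 2 * u (E4 r) - u (E2 r)

/-! ## Card `mirror-certificate-vigour`: the web form of the mirror Cauchy–Schwarz sandwich -/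

/-- the `θ`-invariant slab around the mirror plane `x₀ = x₁` (contains `0` and `a_r`). -/
def slabW (r : ℕ) : Set (Site 3) := {x | 2 * |x 0 - x 1| < (r : ℤ)}
/-- the outer half-space on `b_r`'s side. -/
def Uplus (r : ℕ) : Set (Site 3) := {x | (r : ℤ) ≤ 2 * (x 0 - x 1)}
/-- the outer half-space on `c_r`'s side (`= θ Uplus`). -/
def Uminus (r : ℕ) : Set (Site 3) := {x | (r : ℤ) ≤ 2 * (x 1 - x 0)}

/-- web event `A_W`: `0 ↔ a_r` inside the slab. -/
def Aweb (r : ℕ) : Set (BondConfig (Site 3)) := openConnIn (slabW r) 0 (vA r)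
/-- `b_r` captured through its own half-space (and the slab). -/
def Bcap (r : ℕ) : Set (BondConfig (Site 3)) := openConnIn (slabW r ∪ Uplus r) (vB r) 0
/-- `c_r` captured through its own half-space (and the slab). -/
def Ccap (r : ℕ) : Set (BondConfig (Site 3)) := openConnIn (slabW r ∪ Uminus r) (vC r) 0

/-- the configuration with the slab-internal edge states replaced by their mirror images and all
other edge states kept ("reflect the web, keep the wings"). It has the law of `ω`. -/
def sharpCfg (r : ℕ) (ω : BondConfig (Site 3)) : BondConfig (Site 3) :=
  {e | (e ∈ ω ∧ ¬ (∀ x ∈ e, x ∈ slabW r)) ∨ (Sym2.map theta3 e ∈ ω ∧ (∀ x ∈ e, x ∈ slabW r))}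

/-- `C♯`: `c_r` captured through its half-space by the MIRRORED web. By `θ`-symmetry and the
conditional independence of the two wings given the web, `P(A ∩ B ∩ C♯) = E[1_A m₊²]` while
`P(A ∩ B ∩ C) = E[1_A m₊ m₋]`, `m± =` launching power of the web cluster towards `b` / `c`. -/
def CcapSharp (r : ℕ) : Set (BondConfig (Site 3)) := (sharpCfg r) ⁻¹' (Ccap r)

/-- FIRST LEMMA (card mirror-certificate-vigour; provable now: product structure of
`bondPercolation` over the partition web/wings, invariance under the lattice reflection `θ`,
Cauchy–Schwarz).  In words: `P(A)·(E[1_A m₊m₋] + E[1_A m₊²]) = 2 P(A) E[1_A q̄²] ≥ 2 (E[1_A q̄])²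
= 2 P(A ∩ B)²`, the cross term `E[1_A q̄ ℓ]` vanishing by symmetry.  Hence the web amplitude
`Φ' := P(ABC)P(A)/P(AB)²` satisfies `Φ' - 1 = CV²_A(q̄) - E_A[ℓ²]/E_A[q̄]²` (vigour minus
lopsidedness), and `Φ' ≥ 1 + δ` follows from (V) and (L) below. Valid at every `p`. -/
def MirrorCauchySchwarz : Prop :=
  ∀ (p : unitInterval) (r : ℕ),
    let P := bondPercolation (zdGraph 3) p
    2 * P.real (Aweb r ∩ Bcap r) ^ 2 ≤
      P.real (Aweb r) * (P.real (Aweb r ∩ Bcap r ∩ Ccap r) + P.real (Aweb r ∩ Bcap r ∩ CcapSharp r))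

/-- (V) VIGOUR at `p_c` (crux-level, web form): the launching power of the pinned web cluster is
not self-averaging — Cauchy–Schwarz is missed by a factor `1 + v`. Fails in every factorising
(jump) world, where `m± → θ(p_c)` is deterministic. -/
def WebVigour (v : ℝ) : Prop :=
  ∃ r₀ : ℕ, ∀ r : ℕ, r₀ ≤ r →
    let P := bondPercolation (zdGraph 3) (criticalProbI 3)
    2 * (1 + v) * P.real (Aweb r ∩ Bcap r) ^ 2 ≤
      P.real (Aweb r) * (P.real (Aweb r ∩ Bcap r ∩ Ccap r) + P.real (Aweb r ∩ Bcap r ∩ CcapSharp r))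

/-- (L) LOPSIDEDNESS BOUND at `p_c` (crux-level, web form): capturing `b` twice from the same web
(two independent wings) is at most `1 + η` times as likely as capturing `b` and `c` once each —
`E_A[ℓ²] ≤ (η/(2+η)) E_A[q̄²]`. Fails on the 4-cycle / at small `p` (route competition), where the
certificate is totally lopsided. -/
def WebLopsidedness (η : ℝ) : Prop :=
  ∃ r₀ : ℕ, ∀ r : ℕ, r₀ ≤ r →
    let P := bondPercolation (zdGraph 3) (criticalProbI 3)
    P.real (Aweb r ∩ Bcap r ∩ CcapSharp r) ≤ (1 + η) * P.real (Aweb r ∩ Bcap r ∩ Ccap r)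

/-- (R) RETENTION (web form only; absent in the stopping-set form of the card): the slab/wing
restrictions keep a fraction `λ` of the three-point function. -/
def WebRetention (lam : ℝ) : Prop :=
  ∃ r₀ : ℕ, ∀ r : ℕ, r₀ ≤ r →
    let P := bondPercolation (zdGraph 3) (criticalProbI 3)
    lam * P.real (openConn 0 (vA r) ∩ openConn 0 (vB r)) ≤ P.real (Aweb r ∩ Bcap r)

/-- Bookkeeping target of the web line: (V) ∧ (L) ∧ (R) with `λ²·2(1+v)/(2+η) ≥ 1+δ` give the crux
(monotonicity `τ₄ ≥ P(ABC)`, `τ ≥ P(A)`, and `τ₃ ≤ P(AB)/λ`). -/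
def WebLineCloses : Prop :=
  ∀ v η lam : ℝ, 0 < lam → 0 ≤ η → WebVigour v → WebLopsidedness η → WebRetention lam →
    1 < lam ^ 2 * (2 * (1 + v) / (2 + η)) →
    Summit.CriticalPhenomena.PercolationContinuityZ3.Theses.PercTreeValue.TetrahedronLogConvexity

end

end Summit.CriticalPhenomena.PercolationContinuityZ3.Cruxes.TetrahedronLogConvexity.Ideator2
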